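import Summits.ResolutionOfSingularities.ResolutionOfSingularities.Theorems.PurelyInseparableDim4JointHereditaryStep
import Summits.ResolutionOfSingularities.ResolutionOfSingularities.Theorems.PurelyInseparableDim4JointHereditaryDefs
import Summits.ResolutionOfSingularities.ResolutionOfSingularities.Theorems.PurelyInseparableDim4JointWaitingNodeStep
import Summits.ResolutionOfSingularities.ResolutionOfSingularities.Theorems.PurelyInseparableDim4JointWaitingMember
import HarnessLib

/-!
# Purely inseparable four-folds: the HOST HALF of the node step with HEREDITARY waiting — children and waiting kids of a blown-up
# coordinate member AS `MemberDataH` (brick S3 (c) «joint point∘coordinate chains», part 62 = v3-H, host step; cell `res-dim4-pi`)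

[OURS · counted 0] (D-0157 DOOR 2; desk WORD #66 (4)(c), #74 (g), #99 (d); frame `PIDim4.TerminationImpliesOrderReduction`, S3 (c)
v3-H; host item stmt-ResolutionOfSingularities-16155, helper). Nothing here proves resolution of singularities in dimension ≥ 4 /
characteristic `p` — NOT here, not anywhere in this programme.

Part 52 (`memberData_host_step`) in the v3-H format of part 60: from `MemberDataH p plan leaves wplan M′ c₁ s S wr` the blow-up of `c₁`
yields its CHILDREN as `MemberDataH` at the child pairs WITH THEIR HEREDITARY WAITING ENTRIES `wplan (child pair)` and regions (the
designed limit of the threading chain 49–55 is lifted), its waiting KIDS as `MemberDataH` (no entries below a kid, `BlockH` (H0)),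
each over the host resp. over its region, non-empty; the six disjointness families; the FOUR-WAY cover over the host; the cover off the
host over a waiting region; the finiteness of the leaf points. Everything model-level is read off `BlockH` at the own pair and at the
child pairs; the boundary conditions are the model-free invariants of `MemberDataH` (§1 turns «every boundary component meeting the
member contains it» into the reading `idx D ∈ S` that parts 61b–61d consume).

* §1 `idx_mem_of_member_subset_support`; §2 **`memberDataH_host_step`**.

AI-produced formalisation, weaker than expert review. bears_on: LADDER-RESOLUTION:D157-DOOR2 (res-dim4-pi · S3 (c) joint v3-H · host step).
-/

set_option linter.dupNamespace false -- D-0017: single-problem summit path `Summit.<S>.<S>.…` by design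

noncomputable section

open MvPolynomial Finset CategoryTheory AlgebraicGeometry Opposite TopologicalSpace
open AlgebraicGeometry.Scheme.IdealSheafData (ofIdealTop vanishingIdeal)

namespace Summit.ResolutionOfSingularities.ResolutionOfSingularities.Theorems.PIDim4

open Literature.AlgebraicGeometry.Resolution
open Literature.AlgebraicGeometry.Resolution.Hauser2010
open Literature.AlgebraicGeometry.Resolution.AffinePointBlowup (P A γ coord Wtop ξ)

namespace Equimultiple

/-! ## §1 «Contains the member» in reading form -/

section Reading

variable {K : Type} [Field K] {X' Y : Scheme.{0}} (φ : Y ⟶ X') (ψ : Y ⟶ P 4 K) {S : Finset (Fin 4)}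

/-- **A boundary component containing the member has a fibre-type reading.** If `D` reads `ψ^* V(xᵢ + d)` on a zigzag chart seeing
`V(z, x_S)` and `φ(ψ⁻¹ V(z, x_S)) ⊆ V(D)`, then `i ∈ S`: otherwise the two points `0` and `eᵢ` of `V(z, x_S)` force `d = 0` and `1 = 0`.
[cite: Hauser2010, §G (coordinate hyperplanes through a coordinate subspace)] -/
theorem idx_mem_of_member_subset_support (D : X'.IdealSheafData) {i : Fin 4} {d : K}
    (hD : D.comap φ = (ofIdealTop (Ideal.span {(γ 4 K).symm (X i.succ + C d)})).comap ψ)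
    (hsee : (AffineCoordBlowup.CΛ 4 K (insert 0 (Fin.succ '' (S : Set (Fin 4)))) : Set (P 4 K)) ⊆ Set.range ψ)
    (hsub : φ '' (ψ ⁻¹' (AffineCoordBlowup.CΛ 4 K (insert 0 (Fin.succ '' (S : Set (Fin 4)))) : Set (P 4 K))) ⊆
      (D.support : Set X')) : i ∈ S := by
  by_contra hiS
  -- the reading at a point of `V(z, x_S)` seen by the chart
  have key : ∀ q ∈ (AffineCoordBlowup.CΛ 4 K (insert 0 (Fin.succ '' (S : Set (Fin 4)))) : Set (P 4 K)),
      (X i.succ + C d : A 4 K) ∈ q.asIdeal := by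
    intro q hq
    obtain ⟨y, hy⟩ := hsee hq
    have h1 : φ y ∈ (D.support : Set X') := hsub ⟨y, by rw [Set.mem_preimage, hy]; exact hq, rfl⟩
    have h2 : y ∈ (D.comap φ).support := by rw [Scheme.IdealSheafData.support_comap]; exact h1
    rw [hD, Scheme.IdealSheafData.support_comap] at h2
    have h3 := (mem_support_hyperplane_iff i d (ψ y)).mp h2
    rwa [hy] at h3
  -- at the origin: `d = 0`
  have hξ : (ξ 4 K) ∈ (AffineCoordBlowup.CΛ 4 K (insert 0 (Fin.succ '' (S : Set (Fin 4)))) : Set (P 4 K)) := by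
    rw [SetLike.mem_coe, AffineCoordBlowup.mem_CΛ_iff']
    intro k _
    exact (mem_originIdeal_iff K (4 + 1)).mpr (constantCoeff_X K k)
  have h0 : (X i.succ + C (0 : K) : A 4 K) ∈ (ξ 4 K).asIdeal := by
    rw [C_0, add_zero]; exact (mem_originIdeal_iff K (4 + 1)).mpr (constantCoeff_X K _)
  have hd : d = 0 := eq_of_X_add_C_mem (key _ hξ) h0
  -- at the point `eᵢ` (the translate of the origin by the `i`-th unit vector): contradiction
  set c : Fin 4 → K := fun k => if k = i then 1 else 0 with hc
  have hmem := image_specMap_translate_CΛ (K := K) c Finset.univ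
  have hq : Spec.map (CommRingCat.ofHom ((AffinePointBlowup.translateEquiv (n := 4) (Fin.cases 0 c) : A 4 K ≃ₐ[K] A 4 K) :
      A 4 K →+* A 4 K)) (ξ 4 K) ∈ {x : P 4 K | (X 0 : A 4 K) ∈ x.asIdeal ∧
        ∀ k ∈ (Finset.univ : Finset (Fin 4)), (X k.succ - C (c k) : A 4 K) ∈ x.asIdeal} := by
    rw [← hmem]
    refine ⟨ξ 4 K, ?_, rfl⟩
    rw [SetLike.mem_coe, AffineCoordBlowup.mem_CΛ_iff']
    intro k _
    exact (mem_originIdeal_iff K (4 + 1)).mpr (constantCoeff_X K k)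
  obtain ⟨hq0, hqk⟩ := hq
  set q := Spec.map (CommRingCat.ofHom ((AffinePointBlowup.translateEquiv (n := 4) (Fin.cases 0 c) : A 4 K ≃ₐ[K] A 4 K) :
      A 4 K →+* A 4 K)) (ξ 4 K)
  have hqS : q ∈ (AffineCoordBlowup.CΛ 4 K (insert 0 (Fin.succ '' (S : Set (Fin 4)))) : Set (P 4 K)) := by
    rw [SetLike.mem_coe, AffineCoordBlowup.mem_CΛ_iff']
    rintro k (rfl | ⟨k, hk, rfl⟩)
    · exact hq0
    · have h := hqk k (Finset.mem_univ k)
      have hki : k ≠ i := fun e => hiS (e ▸ hk)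
      have hck : c k = 0 := by simp only [hc, if_neg hki]
      rwa [hck, C_0, sub_zero] at h
  have h1 := key q hqS
  have h2 := hqk i (Finset.mem_univ i)
  have hci : c i = 1 := by simp only [hc, if_true]
  rw [hci] at h2
  rw [hd] at h1
  have h3 : (X i.succ + C (0 : K) : A 4 K) ∈ q.asIdeal := h1
  have h4 : (X i.succ + C (-1 : K) : A 4 K) ∈ q.asIdeal := by rw [C_neg, ← sub_eq_add_neg]; exact h2
  exact one_ne_zero (neg_eq_zero.mp (eq_of_X_add_C_mem h3 h4).symm)

end Reading

/-! ## §2 The host half of the node step -/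

section HostStepH

variable {K : Type} [Field K] {p : ℕ} [hp : Fact p.Prime] [CharP K p] [DecidableEq K]
variable {X' : Scheme.{0}}

/-- **THE HOST HALF OF THE NODE STEP WITH HEREDITARY WAITING.** See the module docstring. `Ce = 𝓘(c₁)`, `π = Bl_{Ce}`,
`M″ = M′.transform π Ce`. [cite: BierstoneGrigorievMilmanWlodarczyk2011, Def. 3.1.3; §4 Step 2b] [cite: Hauser2010, §§F–G]
[cite: GortzWedhorn2020, Prop. 13.91] -/
theorem memberDataH_host_step [IsAlgClosed K] [IsLocallyNoetherian X'] (M' : MarkedIdeal X') (hmult : M'.mult = p)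
    (plan : State K → Finset (Fin 4) → Finset (Fin 4 × (Fin 4 → K) × Finset (Fin 4)))
    (leaves : State K → Finset (Fin 4) → Finset (Fin 4 × (Fin 4 → K)))
    (wplan : State K → Finset (Fin 4) → Finset (Fin 4 × (Fin 4 → K) × Finset (Fin 4)))
    (c₁ : Closeds X') {s : State K} {S : Finset (Fin 4)} {wr : Fin 4 × (Fin 4 → K) × Finset (Fin 4) → Closeds X'}
    (h : MemberDataH p plan leaves wplan M' c₁ s S wr) :
    ∃ (kid : Fin 4 × (Fin 4 → K) × Finset (Fin 4) → Closeds (blowup (vanishingIdeal c₁)))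
      (rgn : Fin 4 × (Fin 4 → K) × Finset (Fin 4) → Fin 4 × (Fin 4 → K) × Finset (Fin 4) → Closeds (blowup (vanishingIdeal c₁)))
      (wkid : Fin 4 × (Fin 4 → K) × Finset (Fin 4) → Closeds (blowup (vanishingIdeal c₁))),
      (∀ e ∈ plan s S,
        MemberDataH p plan leaves wplan (M'.transform (blowup.π (vanishingIdeal c₁)) (vanishingIdeal c₁)) (kid e)
          (CentreBlowup.step p S e.1 e.2.1 s) e.2.2 (rgn e) ∧
        (kid e : Set (blowup (vanishingIdeal c₁))) ⊆ blowup.π (vanishingIdeal c₁) ⁻¹' (c₁ : Set X') ∧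
        (kid e : Set (blowup (vanishingIdeal c₁))).Nonempty ∧
        ∀ wt ∈ wplan (CentreBlowup.step p S e.1 e.2.1 s) e.2.2,
          (rgn e wt : Set (blowup (vanishingIdeal c₁))) ⊆ blowup.π (vanishingIdeal c₁) ⁻¹' (c₁ : Set X')) ∧
      (∀ wt ∈ wplan s S,
        MemberDataH p plan leaves wplan (M'.transform (blowup.π (vanishingIdeal c₁)) (vanishingIdeal c₁)) (wkid wt)
          (CentreBlowup.step p S wt.1 wt.2.1 s) wt.2.2 (fun _ => ⊥) ∧
        (wkid wt : Set (blowup (vanishingIdeal c₁))) ⊆ blowup.π (vanishingIdeal c₁) ⁻¹' (wr wt : Set X') ∧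
        (wkid wt : Set (blowup (vanishingIdeal c₁))).Nonempty) ∧
      (∀ e ∈ plan s S, ∀ e' ∈ plan s S, e ≠ e' →
        Disjoint (kid e : Set (blowup (vanishingIdeal c₁))) (kid e' : Set (blowup (vanishingIdeal c₁)))) ∧
      (∀ e ∈ plan s S, ∀ wt ∈ wplan s S,
        Disjoint (kid e : Set (blowup (vanishingIdeal c₁))) (wkid wt : Set (blowup (vanishingIdeal c₁)))) ∧
      (∀ wt ∈ wplan s S, ∀ wt' ∈ wplan s S, wt ≠ wt' →
        Disjoint (wkid wt : Set (blowup (vanishingIdeal c₁))) (wkid wt' : Set (blowup (vanishingIdeal c₁)))) ∧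
      (∀ e ∈ plan s S, ∀ wt ∈ wplan (CentreBlowup.step p S e.1 e.2.1 s) e.2.2, ∀ e' ∈ plan s S, e' ≠ e →
        Disjoint (rgn e wt : Set (blowup (vanishingIdeal c₁))) (kid e' : Set (blowup (vanishingIdeal c₁)))) ∧
      (∀ e ∈ plan s S, ∀ wt ∈ wplan (CentreBlowup.step p S e.1 e.2.1 s) e.2.2, ∀ wt₀ ∈ wplan s S,
        Disjoint (rgn e wt : Set (blowup (vanishingIdeal c₁))) (wkid wt₀ : Set (blowup (vanishingIdeal c₁)))) ∧
      (∀ e ∈ plan s S, ∀ wt ∈ wplan (CentreBlowup.step p S e.1 e.2.1 s) e.2.2,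
        ∀ e' ∈ plan s S, ∀ wt' ∈ wplan (CentreBlowup.step p S e'.1 e'.2.1 s) e'.2.2, (e, wt) ≠ (e', wt') →
        Disjoint (rgn e wt : Set (blowup (vanishingIdeal c₁))) (rgn e' wt' : Set (blowup (vanishingIdeal c₁)))) ∧
      (∀ w : blowup (vanishingIdeal c₁), IsClosed ({w} : Set (blowup (vanishingIdeal c₁))) →
        blowup.π (vanishingIdeal c₁) w ∈ (c₁ : Set X') →
        (p : ℕ∞) ≤ idealOrder (M'.transform (blowup.π (vanishingIdeal c₁)) (vanishingIdeal c₁)).ideal w →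
        (∃ e ∈ plan s S, w ∈ (kid e : Set (blowup (vanishingIdeal c₁)))) ∨
        (∃ wt ∈ wplan s S, w ∈ (wkid wt : Set (blowup (vanishingIdeal c₁)))) ∨
        (∃ e ∈ plan s S, ∃ wt ∈ wplan (CentreBlowup.step p S e.1 e.2.1 s) e.2.2,
          w ∈ (rgn e wt : Set (blowup (vanishingIdeal c₁)))) ∨
        ∃ l ∈ leaves s S, l.1 ∈ S ∧ l.2 l.1 = 0 ∧ CentreBlowup.IsEquimultiplePoint p S l.1 l.2 s ∧
          ∃ (Y' : Scheme.{0}) (φ' : Y' ⟶ blowup (vanishingIdeal c₁)) (ψ' : Y' ⟶ P 4 K) (_ : IsOpenImmersion φ')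
            (_ : IsOpenImmersion ψ') (y' : Y'), φ' y' = w ∧ ψ' y' = ξ 4 K ∧
            (M'.transform (blowup.π (vanishingIdeal c₁)) (vanishingIdeal c₁)).ideal.comap φ' =
              (hypSheaf p (CentreBlowup.step p S l.1 l.2 s).F).comap ψ') ∧
      (∀ w : blowup (vanishingIdeal c₁), IsClosed ({w} : Set (blowup (vanishingIdeal c₁))) →
        (p : ℕ∞) ≤ idealOrder (M'.transform (blowup.π (vanishingIdeal c₁)) (vanishingIdeal c₁)).ideal w →
        blowup.π (vanishingIdeal c₁) w ∉ (c₁ : Set X') →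
        ∀ wt ∈ wplan s S, blowup.π (vanishingIdeal c₁) w ∈ (wr wt : Set X') →
          w ∈ (wkid wt : Set (blowup (vanishingIdeal c₁)))) ∧
      {w : blowup (vanishingIdeal c₁) | IsClosed ({w} : Set (blowup (vanishingIdeal c₁))) ∧
        blowup.π (vanishingIdeal c₁) w ∈ (c₁ : Set X') ∧
        (p : ℕ∞) ≤ idealOrder (M'.transform (blowup.π (vanishingIdeal c₁)) (vanishingIdeal c₁)).ideal w ∧
        (∀ e ∈ plan s S, w ∉ (kid e : Set (blowup (vanishingIdeal c₁)))) ∧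
        (∀ wt ∈ wplan s S, w ∉ (wkid wt : Set (blowup (vanishingIdeal c₁)))) ∧
        ∀ e ∈ plan s S, ∀ wt ∈ wplan (CentreBlowup.step p S e.1 e.2.1 s) e.2.2,
          w ∉ (rgn e wt : Set (blowup (vanishingIdeal c₁)))}.Finite := by
  classical
  obtain ⟨hF, hclean, hS, hreg, hsnc, hchart, hblocks, hacc, hinv, hHBflag⟩ := h
  obtain ⟨Y, φ, ψ, _, _, hM, hZ, hcφ, hsee, ⟨idx, cst_, hshape, hinj⟩, hregions⟩ := hchart
  obtain ⟨hP1, hP2, hP3, hW1, hW2, hPW, hH1, hH0, hH2a, hH2b, hH2c, hP5⟩ := hblocks (s, S) Relation.ReflTransGen.refl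
  set Ce : X'.IdealSheafData := vanishingIdeal c₁ with hCe
  have hπ : IsBlowup (blowup.π Ce) Ce := blowup.isBlowup Ce
  haveI : IsProper (blowup.π Ce) := hπ.isProper
  haveI : IsLocallyNoetherian (blowup Ce) := LocallyOfFiniteType.isLocallyNoetherian (blowup.π Ce)
  have himg := coe_member_eq_image φ ψ c₁ hZ hcφ
  have hT : IsClosed (φ '' (ψ ⁻¹' (AffineCoordBlowup.CΛ 4 K (insert 0 (Fin.succ '' (S : Set (Fin 4)))) : Set (P 4 K)))) :=
    himg ▸ c₁.isClosed
  -- the model and the comparison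
  set B := blowup.π (AffineCoordBlowup.𝓘Λ 4 K (insert 0 (Fin.succ '' (S : Set (Fin 4))))) with hBdef
  have hB : IsBlowup B (AffineCoordBlowup.𝓘Λ 4 K (insert 0 (Fin.succ '' (S : Set (Fin 4))))) := blowup.isBlowup _
  obtain ⟨ε, hsq, hC', hKEY⟩ := ChartDictionary.exists_iso_restrict_blowup_zigzag φ ψ _ Ce hZ hπ hB
  have hK := hKEY M'.ideal (hypSheaf p s.F) p hM
  -- the block at a child pair and at a kid pair
  have hstepP : ∀ e ∈ plan s S, HEdge p plan wplan (CentreBlowup.step p S e.1 e.2.1 s, e.2.2) (s, S) :=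
    fun e he => Or.inl ⟨e, he, rfl⟩
  have hstepW : ∀ wt ∈ wplan s S, HEdge p plan wplan (CentreBlowup.step p S wt.1 wt.2.1 s, wt.2.2) (s, S) :=
    fun wt hwt => Or.inr ⟨wt, hwt, rfl⟩
  have hblockP : ∀ e ∈ plan s S, BlockH p plan leaves wplan (CentreBlowup.step p S e.1 e.2.1 s, e.2.2) := fun e he =>
    hblocks _ (Relation.ReflTransGen.single (hstepP e he))
  -- hypotheses of the step
  set Hd : Fin 4 × (Fin 4 → K) × Finset (Fin 4) → Finset (Fin 4 × (Fin 4 → K) × Finset (Fin 4)) := fun e =>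
    wplan (CentreBlowup.step p S e.1 e.2.1 s) e.2.2 with hHd
  have hH1' : ∀ e ∈ plan s S, ∀ wt ∈ Hd e, wt.2.1 e.1 = 0 ∧ (∀ i ∈ S, wt.2.1 i = 0) ∧ S.erase e.1 ⊆ wt.2.2 ∧ e.1 ∈ wt.2.2 := by
    intro e he wt hwt
    obtain ⟨hnS, hjT, hc0⟩ := hH1 e he wt hwt
    obtain ⟨-, hcS'', -, hsubT, -, -⟩ := (hblockP e he).2.2.2.1 wt hwt
    refine ⟨hc0, fun i hi => hcS'' i ((hP1 e he).2.2.1 hi), fun i hi => ?_, hjT⟩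
    obtain ⟨-, hiS⟩ := Finset.mem_erase.mp hi
    exact hsubT (Finset.mem_erase.mpr ⟨fun h => hnS (h ▸ hiS), (hP1 e he).2.2.1 hiS⟩)
  have hWHd : ∀ e ∈ plan s S, ∀ wt ∈ Hd e,
      (p : ℕ∞) ≤ CentreBlowup.ordAlong wt.2.2 (PointBlowup.translate wt.2.1 (CentreBlowup.step p S e.1 e.2.1 s).F) :=
    fun e he wt hwt => ((hblockP e he).2.2.2.1 wt hwt).2.2.2.2.2.2
  have hW1' : ∀ wt ∈ wplan s S, wt.1 ∈ S ∧ (∀ i ∈ S, wt.2.1 i = 0) ∧ S.erase wt.1 ⊆ wt.2.2 ∧ wt.1 ∉ wt.2.2 ∧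
      IsPermissibleCentre p wt.2.2 (CentreBlowup.step p S wt.1 wt.2.1 s).F := fun wt hwt => by
    obtain ⟨hj, hcS, hcT, hsub, hjT, hperm⟩ := hW1 wt hwt
    exact ⟨hj, hcS, hsub, hjT, isPermissibleCentre_step_of_waiting hj hjT (fun i _ hi => hcS i hi) hcT s hperm⟩
  have hWsee : ∀ wt ∈ wplan s S, waitingSetZ wt ⊆ Set.range ψ := fun wt hwt => (hregions wt hwt).2
  have hWc : ∀ wt ∈ wplan s S, IsClosed (φ '' (ψ ⁻¹' waitingSetZ wt)) := fun wt hwt => by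
    rw [← (hregions wt hwt).1]; exact (wr wt).isClosed
  have hne₁ : (c₁ : Set X').Nonempty := by
    have hξ : (ξ 4 K) ∈ (AffineCoordBlowup.CΛ 4 K (insert 0 (Fin.succ '' (S : Set (Fin 4)))) : Set (P 4 K)) := by
      rw [SetLike.mem_coe, AffineCoordBlowup.mem_CΛ_iff']
      intro k _
      exact (mem_originIdeal_iff K (4 + 1)).mpr (constantCoeff_X K k)
    obtain ⟨y, hy⟩ := hsee hξ
    exact ⟨φ y, himg ▸ ⟨y, by rw [Set.mem_preimage, hy]; exact hξ, rfl⟩⟩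
  have hWinv : ∀ wt ∈ wplan s S, ∀ D ∈ M'.boundary, Disjoint (D.support : Set X') (φ '' (ψ ⁻¹' waitingSetZ wt)) ∨
      ((D.support : Set X') ∩ φ '' (ψ ⁻¹'
        (AffineCoordBlowup.CΛ 4 K (insert 0 (Fin.succ '' (S : Set (Fin 4)))) : Set (P 4 K)))).Nonempty := by
    intro wt hwt D hD
    rcases hinv wt hwt D hD with h | ⟨h, -⟩
    · left; rwa [← (hregions wt hwt).1]
    · right
      rw [himg]
      obtain ⟨x, hx⟩ := hne₁
      exact ⟨x, h hx, hx⟩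
  -- the reading form of «every boundary component meeting c₁ contains it»
  have hHBread : (∀ D ∈ M'.boundary, ((D.support : Set X') ∩ (c₁ : Set X')).Nonempty → (c₁ : Set X') ⊆ D.support) →
      ∀ D ∈ M'.boundary, ((D.support : Set X') ∩ φ '' (ψ ⁻¹'
        (AffineCoordBlowup.CΛ 4 K (insert 0 (Fin.succ '' (S : Set (Fin 4)))) : Set (P 4 K)))).Nonempty → idx D ∈ S := by
    intro hHB D hD hm
    obtain ⟨hDi, -⟩ := hshape D hD hm
    rw [himg] at hm
    exact idx_mem_of_member_subset_support φ ψ D hDi hsee (himg ▸ hHB D hD hm)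
  -- the step
  obtain ⟨kid, rgn, wkid, hkid, hwkid, hkdisj, hkw, hww, hrk, hrw, hrr, hkcover, hwcover, hkfin⟩ :=
    joint_forest_step_hereditary φ ψ ε Ce hπ hB hsq hC' M' hmult s hK hS hsee hT hsnc idx cst_ hshape hinj (plan s S) hP1 hP2
      Hd hH1' hH2a hH2c (wplan s S) hH2b hWHd hW1' (fun wt hwt => (hW1 wt hwt).2.2.2.2.2.2) hW2 hPW hWsee hWc hWinv
      (leaves s S) hP5
  refine ⟨kid, rgn, wkid, fun e he => ?_, fun wt hwt => ?_, hkdisj, hkw, hww, hrk, hrw, hrr, fun w hw hwx hord => ?_,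
    fun w hw hord hoff wt hwt hwT => ?_, ?_⟩
  · -- a child as `MemberDataH` WITH its hereditary waiting entries
    obtain ⟨hregk, hsnck, hzig, hover, hne, hrover, hHB, -⟩ := hkid e he
    obtain ⟨hj, hbj, hsub, heq, hperm''⟩ := hP1 e he
    have hHBc : (wplan (CentreBlowup.step p S e.1 e.2.1 s) e.2.2).Nonempty →
        ∀ D ∈ M'.boundary, ((D.support : Set X') ∩ (c₁ : Set X')).Nonempty → (c₁ : Set X') ⊆ D.support :=
      fun hne' => hHBflag ⟨e, he, _, Relation.ReflTransGen.refl, hne'⟩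
    refine ⟨⟨step_F_ne_zero_of_isClean hj e.2.1 s hF hclean hS.2, isClean_step S e.1 e.2.1 s, hperm'', hregk, hsnck, hzig,
      fun q hq => hblocks q (Relation.ReflTransGen.head (hstepP e he) hq), hacc.inv (hstepP e he),
      fun wt hwt D hD => (hHB (hHBread (hHBc ⟨wt, hwt⟩))).2 wt hwt D hD, fun hpre D hD hm => ?_⟩,
      fun w hw => by have h := hover hw; rwa [Set.mem_preimage, himg] at h, hne,
      fun wt hwt w hw => by have h := hrover wt hwt hw; rwa [Set.mem_preimage, himg] at h⟩
    obtain ⟨e', he', q, hq, hne'⟩ := hpre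
    have hpre₁ : ∃ e ∈ plan s S, ∃ q : State K × Finset (Fin 4),
        Relation.ReflTransGen (fun a b : State K × Finset (Fin 4) => HEdge p plan wplan b a)
          (CentreBlowup.step p S e.1 e.2.1 s, e.2.2) q ∧ (wplan q.1 q.2).Nonempty :=
      ⟨e, he, q, Relation.ReflTransGen.head (Or.inl ⟨e', he', rfl⟩) hq, hne'⟩
    exact (hHB (hHBread (hHBflag hpre₁))).1 D hD hm
  · -- a waiting kid as `MemberDataH` (no waiting entries at or below it)
    obtain ⟨hregk, hsnck, hzig, hproj, hne⟩ := hwkid wt hwt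
    obtain ⟨hj, hc0, hsub, hjT, hperm''⟩ := hW1' wt hwt
    have h0 : wplan (CentreBlowup.step p S wt.1 wt.2.1 s) wt.2.2 = ∅ := hH0 wt hwt _ Relation.ReflTransGen.refl
    obtain ⟨Y'', φ'', ψ'', _, _, h1, h2, h3, h4, h5⟩ := hzig
    refine ⟨⟨step_F_ne_zero_of_isClean hj wt.2.1 s hF hclean hS.2, isClean_step S wt.1 wt.2.1 s, hperm'', hregk, hsnck,
      ⟨Y'', φ'', ψ'', inferInstance, inferInstance, h1, h2, h3, h4, h5, fun wt' hwt' => ?_⟩,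
      fun q hq => hblocks q (Relation.ReflTransGen.head (hstepW wt hwt) hq), hacc.inv (hstepW wt hwt),
      fun wt' hwt' => ?_, fun hpre => ?_⟩, fun w hw => ?_, hne⟩
    · rw [h0] at hwt'; exact absurd hwt' (Finset.notMem_empty wt')
    · rw [h0] at hwt'; exact absurd hwt' (Finset.notMem_empty wt')
    · obtain ⟨e', he', q, hq, hne'⟩ := hpre
      have hq' : Relation.ReflTransGen (fun a b : State K × Finset (Fin 4) => HEdge p plan wplan b a)
          (CentreBlowup.step p S wt.1 wt.2.1 s, wt.2.2) q := Relation.ReflTransGen.head (Or.inl ⟨e', he', rfl⟩) hq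
      have h0' := hH0 wt hwt q hq'
      rw [h0'] at hne'
      exact absurd hne' Finset.not_nonempty_empty
    · rw [Set.mem_preimage, (hregions wt hwt).1]
      exact hproj w hw
  · -- four-way cover over the host
    rw [← himg] at hwx
    exact hkcover w hw hwx hord
  · -- cover off the host over a waiting region
    refine hwcover w hw hord (by rw [himg]; exact hoff) wt hwt ?_
    rw [(hregions wt hwt).1] at hwT
    exact hwT
  · -- finiteness of the leaf points
    rw [himg] at hkfin
    exact hkfin

end HostStepH

end Equimultiple

end Summit.ResolutionOfSingularities.ResolutionOfSingularities.Theorems.PIDim4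

end
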